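import Summits.CriticalPhenomena.PercolationContinuityZ3.Theorems.Transplant.FKConnectivityAllQForestHubPairDecomposition
import HarnessLib

/-!
# CLUSTER REPULSION (node `ClusterRepulsionOn`, NOT asserted) and the kernel arrow: cluster repulsion at ONE vertex ⇒ the
# square-free adjacent forest Rayleigh node `AdjForestRayleighNoSqOn`

Support file (`--supports stmt-CriticalPhenomena-4575`), FK sub-lane `prim-bschramm-fk-1` (gen 27) of the post-continuity programme;
builds on p205010 (kernel theorem, internal audit signed; external expert review pending).  Two definitions (one counting predicate, one
`@[conjecture]` node — NOT asserted; the avoidance event `avoidEv` is vdBHK's `{o ↮ P}` of `…TwoClusterAssoc.lean`), no named facts, no sorries; standard axioms.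

THE NODE (♣)⁰ = `AdjForestRayleighNoSqOn V` (`…TwoClusterRayleighNoSq.lean`): on every fibre `(M, u₀)` and all `e = ov ≠ f = oy`,
`bad := #(Fo ∩ {e,f ∈ ω}, Fo) ≤ good := #(Fo ∩ {e ∈ ω}, Fo ∩ {f ∈ ω})`; in colouring language (uniformly random ordered partition
`(A, B)` of the pairs of a finite multigraph into two forests): `P(e, f ∈ A) ≤ P(e ∈ A, f ∈ B)`.

NEW NODE — CLUSTER REPULSION (memo bschramm/FROM-fk-1-g27-CLUSTER-REPULSION.md): for a fibre `(M, u₀)`, a pair `f = oy` and ANY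
vertex set `P`, **`#(Fo ∩ {f ∈ ω} ∩ {C_ω(o) ∩ P = ∅}, Fo) ≤ #(Fo ∩ {C_ω(o) ∩ P = ∅}, Fo ∩ {f ∈ ω})`**, where `C_ω(o)` is the open
cluster of `o`; in colouring language **`P(f ∈ A | the A-cluster of o avoids P) ≤ 1/2`**, equivalently (involution `ω ↦ ω ∆ M`)
**given `f = oy ∈ A`, `o` is at least as likely to be A-joined to the set `P` as B-joined to it**.  The case `P = {v}` on the fibre
`(M ∖ {e}, u₀)` IS the node's inequality on `(M, u₀)` (`e = ov` free): `bad = #(Fo ∩ {f ∈ ω} ∩ {o ↮ v}, Fo)` and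
`good = #(Fo ∩ {o ↮ v}, Fo ∩ {f ∈ ω})` after deleting `e` (**`adjForestRayleighNoSqOn_of_clusterRepulsion`**, this file); the case
`|P| = 2` on `G' − v` is the node at a vertex `v` of degree 3 (memo §2, identity `bad − good = 2·Q_{{p,q}}(G' − v)`).  Evidence (exact,
two engines): 0 violations over ALL `(K, o, f, P)` with `K` a connected graph on ≤ 7 vertices (862,265,124 cells at `n = 7`), 0 in
3,500 random multigraph instances with 8–24 vertices (frontier transfer-matrix engine); the natural strengthenings are FALSE (memo §3:
size down-sets `{|C_A(o)| ≤ k}`, unions of two avoidance events, products with a B-avoidance or an A/B-separation literal), the product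
with a B-JOIN literal `[x ∈ C_B(o)]` holds (0 / 517,120, `n = 5`).
[cite: SempleWelsh2008, Conj. 1.1 (p. 2); Thm. 4.2 (p. 11)] [cite: Linusson2011, Prop. 2.6] [cite: Grimmett2006, §1.5 (p. 13)]
-/

noncomputable section

namespace Summit.CriticalPhenomena.PercolationContinuityZ3.Theorems
namespace FK

open MeasureTheory Set Literature.Probability.LatticeModels Literature.Probability.Percolation
open scoped Classical symmDiff

variable {V : Type*} [Fintype V]

/-! ### The avoidance event and the node -/

-- `avoidEv o P = {ω | ∀ p ∈ P, ¬ (openGraph ω).Reachable o p}` is vdBHK's avoidance event `{o ↮ P}` (`…TwoClusterAssoc.lean`).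

/-- **Cluster repulsion on the vertex type `V`** (CR): on every fibre `(M, u₀)`, for every pair `f = oy` and every vertex set `P`,
`#(Fo ∩ {f ∈ ω} ∩ {C_ω(o) ∩ P = ∅}, Fo) ≤ #(Fo ∩ {C_ω(o) ∩ P = ∅}, Fo ∩ {f ∈ ω})` — in a uniformly random ordered two-forest colouring,
`P(f ∈ A | the A-cluster of o avoids P) ≤ 1/2`.  Counting predicate, NOT asserted. [cite: SempleWelsh2008, Conj. 1.1 (p. 2)]
[cite: Linusson2011, Prop. 2.6] -/
def ClusterRepulsionOn (V : Type*) [Fintype V] : Prop :=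
  ∀ (M u₀ : BondConfig V), Disjoint u₀ M → ∀ (o y : V) (P : Set V),
    fibreCount M u₀ (forestEv V ∩ {ω | s(o, y) ∈ ω} ∩ avoidEv o P) (forestEv V) ≤
      fibreCount M u₀ (forestEv V ∩ avoidEv o P) (forestEv V ∩ {ω | s(o, y) ∈ ω})

/-- **Cluster repulsion on every finite vertex type.**  CONJECTURE-SHAPED COUNTING STATEMENT, NOT asserted.  Evidence (fk-1 g27, exact,
two engines): 0 violations over all `(K, o, f, P)` on connected graphs with ≤ 7 vertices (8.6·10⁸ cells at `n = 7`) and in 3,500 random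
multigraph instances with 8–24 vertices.  Its one-vertex case implies (indeed is) the node `AdjForestRayleighNoSqPos`
(`adjForestRayleighNoSqPos_of_clusterRepulsionPos`). [cite: SempleWelsh2008, Conj. 1.1 (p. 2)] [cite: Linusson2011, Prop. 2.6] -/
@[conjecture] def ClusterRepulsionPos : Prop := ∀ n : ℕ, ClusterRepulsionOn (Fin n)

/-! ### Cluster repulsion at one vertex ⇒ the node -/

section Arrow

variable {M u₀ : BondConfig V} {o v y : V}

/-- **Deleting the free pair `e = ov`: `bad`** on `(N ∪ {e}, u₀)` is `#(Fo ∩ {f ∈ ω} ∩ {o ↮ v}, Fo)` on `(N, u₀)`.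
[cite: Linusson2011, Prop. 2.6] [cite: Grimmett2006, §1.5 (p. 13)] -/
theorem adjForestNoSq_bad_eq_delete {N : BondConfig V} (hov : o ≠ v) (heN : s(o, v) ∉ N) (heu : s(o, v) ∉ u₀)
    (hef : s(o, v) ≠ s(o, y)) :
    fibreCount (insert s(o, v) N) u₀ (forestEv V ∩ {ω | s(o, v) ∈ ω ∧ s(o, y) ∈ ω}) (forestEv V) =
      fibreCount N u₀ (forestEv V ∩ {ω | s(o, y) ∈ ω} ∩ avoidEv o {v}) (forestEv V) := by
  rw [fibreCount_insert_one heN,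
    fibreCount_eq_zero_of_forall N u₀ ({ω | s(o, v) ∉ ω} ∩ (forestEv V ∩ {ω | s(o, v) ∈ ω ∧ s(o, y) ∈ ω})) _
      (fun ω _ hA _ => hA.1 hA.2.2.1), add_zero]
  refine fibreCount_congr_fibre N u₀ fun ω hω => ?_
  have hno := notMem_and_notMem_symmDiff_of_fibre heN heu hω
  have h1 := insert_mem_forestEv_iff hov hno.1
  constructor
  · rintro ⟨⟨-, hF, -, hf⟩, -, hFB⟩
    have hF' := h1.1 hF
    refine ⟨⟨⟨hF'.1, ?_⟩, fun p hp => ?_⟩, hFB⟩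
    · rcases (mem_insert_iff.1 hf) with hfe | hfω
      · exact absurd hfe.symm hef
      · exact hfω
    · rw [mem_singleton_iff.1 hp]; exact fun hr => hF'.2 (mem_reachEv.2 hr)
  · rintro ⟨⟨⟨hF, hf⟩, hav⟩, hFB⟩
    exact ⟨⟨hno.1, h1.2 ⟨hF, fun hr => hav v rfl (mem_reachEv.1 hr)⟩, mem_insert _ _, mem_insert_of_mem _ hf⟩, hno.2, hFB⟩

/-- **Deleting the free pair `e = ov`: `good`** on `(N ∪ {e}, u₀)` is `#(Fo ∩ {o ↮ v}, Fo ∩ {f ∈ ω})` on `(N, u₀)`.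
[cite: Linusson2011, Prop. 2.6] [cite: Grimmett2006, §1.5 (p. 13)] -/
theorem adjForestNoSq_good_eq_delete {N : BondConfig V} (hov : o ≠ v) (heN : s(o, v) ∉ N) (heu : s(o, v) ∉ u₀) :
    fibreCount (insert s(o, v) N) u₀ (forestEv V ∩ {ω | s(o, v) ∈ ω}) (forestEv V ∩ {ω | s(o, y) ∈ ω}) =
      fibreCount N u₀ (forestEv V ∩ avoidEv o {v}) (forestEv V ∩ {ω | s(o, y) ∈ ω}) := by
  rw [fibreCount_insert_one heN,
    fibreCount_eq_zero_of_forall N u₀ ({ω | s(o, v) ∉ ω} ∩ (forestEv V ∩ {ω | s(o, v) ∈ ω})) _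
      (fun ω _ hA _ => hA.1 hA.2.2), add_zero]
  refine fibreCount_congr_fibre N u₀ fun ω hω => ?_
  have hno := notMem_and_notMem_symmDiff_of_fibre heN heu hω
  have h1 := insert_mem_forestEv_iff hov hno.1
  constructor
  · rintro ⟨⟨-, hF, -⟩, -, hFB, hf⟩
    have hF' := h1.1 hF
    refine ⟨⟨hF'.1, fun p hp => ?_⟩, hFB, hf⟩
    rw [mem_singleton_iff.1 hp]; exact fun hr => hF'.2 (mem_reachEv.2 hr)
  · rintro ⟨⟨hF, hav⟩, hFB, hf⟩
    exact ⟨⟨hno.1, h1.2 ⟨hF, fun hr => hav v rfl (mem_reachEv.1 hr)⟩, mem_insert _ _⟩, hno.2, hFB, hf⟩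

end Arrow

/-- **CLUSTER REPULSION AT ONE VERTEX ⇒ THE SQUARE-FREE ADJACENT FOREST RAYLEIGH NODE.**  If `ClusterRepulsionOn V` holds then
`bad ≤ good` on every fibre, i.e. `AdjForestRayleighNoSqOn V`: delete the free pair `e = ov` and apply (CR) with `P = {v}` on the
smaller fibre; a pinned or absent `e` gives `bad = good` resp. `bad = 0`. [cite: SempleWelsh2008, Conj. 1.1 (p. 2)]
[cite: Linusson2011, Prop. 2.6] [cite: Grimmett2006, §1.5 (p. 13)] -/
theorem adjForestRayleighNoSqOn_of_clusterRepulsion (h : ClusterRepulsionOn V) : AdjForestRayleighNoSqOn V := by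
  intro M u₀ hd o v y hvy
  have hef : s(o, v) ≠ s(o, y) := fun h' => hvy (Sym2.congr_right.1 h')
  by_cases heM : s(o, v) ∈ M
  · by_cases hov : o = v
    · subst hov
      rw [fibreCount_eq_zero_of_forall _ _ _ _ fun ω _ hA _ => hA.1.1 _ hA.2.1 (Sym2.mk_isDiag_iff.2 rfl)]
      exact Nat.zero_le _
    set N := M \ {s(o, v)} with hNdef
    have heN : s(o, v) ∉ N := fun h' => h'.2 rfl
    have heu : s(o, v) ∉ u₀ := fun h' => hd.le_bot ⟨h', heM⟩
    have hMN : M = insert s(o, v) N := by rw [hNdef, insert_sdiff_singleton, insert_eq_of_mem heM]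
    have hdN : Disjoint u₀ N := hd.mono_right (hNdef ▸ sdiff_subset)
    rw [hMN, adjForestNoSq_bad_eq_delete hov heN heu hef, adjForestNoSq_good_eq_delete hov heN heu]
    exact h N u₀ hdN o y {v}
  · by_cases heu : s(o, v) ∈ u₀
    · exact (adjForestNoSq_bad_eq_good_of_pinned hd heu).le
    · rw [adjForestNoSq_bad_eq_zero_of_notMem heM heu]; exact Nat.zero_le _

/-- **`ClusterRepulsionPos → AdjForestRayleighNoSqPos`** (hence adjacent-edge negative correlation of the arboreal gas on every finite graph,
`ag_adjacent_negCorr_of_adjForestNoSq`). [cite: SempleWelsh2008, Conj. 1.1 (p. 2)] [cite: Grimmett2006, §1.5 (p. 13)] -/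
theorem adjForestRayleighNoSqPos_of_clusterRepulsionPos (h : ClusterRepulsionPos) : AdjForestRayleighNoSqPos :=
  fun n => adjForestRayleighNoSqOn_of_clusterRepulsion (h n)

end FK
end Summit.CriticalPhenomena.PercolationContinuityZ3.Theorems

end
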